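import Mathlib
import Literature.Analysis.FluidPDE.BallRadialMoments
import Summits.NavierStokesRegularity.NavierStokesRegularity.Theorems.EulerZoomLiouvillePowerGaugeEulerLiouvilleBallMeanValue
import Summits.NavierStokesRegularity.NavierStokesRegularity.Theorems.EulerZoomLiouvillePowerGaugeEulerLiouvilleSphereMeanValue

/-!
# R49/R50 plates, TOOLS for the α-FAMILY of shell laws (nsreg-p2 ROUND-49 `TwoSphereLaw`, ROUND-50 §4 `TransportShellLaw γ α` /
# `TransportShellLawDeriv γ α`; seat ns-ezl-w2 g6, `--supports stmt-NavierStokesRegularity-19832 --as helper`)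

The second shortcut (ns-ezl-w2 g6 bus 04:24:59Z): NO new cut-off analysis is needed for Chae–Wolf's `‖x − x₀‖^{−α}` family (2.8).
For ANY continuous pair `(U, Q)` satisfying the tent mean-value formula about `x₀` at every radius
(`∫_{B_ρ(x₀)}(⟪U,z⟫²/‖z‖ + ‖z‖Q) = ∫_{B_ρ(x₀)}(ρ − ‖z‖)(‖U‖² + 3Q)`, `z = y − x₀` — ns-sfl-p1 g8's `meanValueFormula_of_radialVirial`
for `γ`-profiles, and for the transport pair `(W, Π̂_{x₀})` via `transportRadialVirialIdentity`), the function
`G(t) = t³·S(t)`, `S(t) = ∫_σ(⟪U(tα+x₀),α⟫² + Q(tα+x₀))dσ` (`= sphereIntegral(U_n² + Q)(t)`), equals `∫₀ᵗ τ²·S_f(τ)dτ` with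
`S_f = sphereIntegral(‖U‖² + 3Q)` (sphere mean-value formula + polar coordinates), hence is `C¹` on `(0,∞)` with `G′ = t²S_f`; the
product rule for `t^{−α}·G(t) = t^{3−α}S(t)` gives the DIFFERENTIAL SHELL LAW

  `d/dt [t^{3−α}·sphereIntegral(U_n² + Q)(t)] = t^{2−α}·sphereIntegral(‖U‖² − αU_n² + (3−α)Q)(t)`   (`hasDerivAt_rpow_mul_sphereIntegral_of_meanValue`),

and the fundamental theorem of calculus on `[r₁, r₂]` plus polar coordinates on the shell give the INTEGRATED SHELL LAW

  `r₂^{3−α}S(r₂) − r₁^{3−α}S(r₁) = ∫_{B_{r₂}(x₀)∖B_{r₁}(x₀)} ‖z‖^{−α}(‖U‖² − αU_n² + (3−α)Q) dy`          (`shellLaw_of_meanValue`),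

for every real `α` and `0 < r₁ < r₂` — Chae–Wolf (2.8) for the pair.  Also: polar coordinates on a shell about `x₀`
(`setIntegral_shell_eq_intervalIntegral_sphereIntegral`), `sphereIntegral_radial_fun` (`sphereIntegral(g(‖z‖))(r) = 4πg(r)`).

HONEST FRAMING: class-free calculus (ROUND-49/50 instrument statements); nothing about the crux E (19832 OPEN) or NS regularity.
[cite: ChaeWolf2016, Remark 2.3 (2.8)] [folklore (polar coordinates, FTC)]
-/

noncomputable section

set_option linter.dupNamespace false

open MeasureTheory Set Filter Topology Metric Function TopologicalSpace
open scoped ENNReal NNReal RealInnerProductSpace Topology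

namespace Summit.NavierStokesRegularity.NavierStokesRegularity.Theorems.PowerGaugeEulerLiouville

open Literature.Analysis Literature.Analysis.FunctionSpaces Literature.Analysis.FluidPDE

namespace ClassicalProfile

/-! ## Sphere integrals: integrability, radial functions -/

/-- A continuous function on the unit sphere is integrable for the sphere measure. [folklore] -/
theorem integrable_sphere_of_continuous {f : sphere (0 : EuclideanSpace ℝ (Fin 3)) 1 → ℝ} (hf : Continuous f) :
    Integrable f (volume : Measure (EuclideanSpace ℝ (Fin 3))).toSphere :=
  hf.integrable_of_hasCompactSupport (HasCompactSupport.of_compactSpace _)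

/-- **Sphere integral of a radial function**: `sphereIntegral volume (z ↦ g(‖z‖)) r = 4π·g(r)` for `r ≥ 0`
(`σ(S²) = 3·|B₁| = 4π`). [folklore] -/
theorem sphereIntegral_radial_fun (g : ℝ → ℝ) {r : ℝ} (hr : 0 ≤ r) :
    sphereIntegral volume (fun z : EuclideanSpace ℝ (Fin 3) => g ‖z‖) r = 4 * Real.pi * g r := by
  rw [sphereIntegral_def]
  have h : ∀ α : sphere (0 : EuclideanSpace ℝ (Fin 3)) 1, g ‖r • (α : EuclideanSpace ℝ (Fin 3))‖ = g r := fun α => by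
    rw [norm_smul_sphere hr α]
  rw [integral_congr_ae (Eventually.of_forall h), integral_const, smul_eq_mul, Measure.toSphere_real_apply_univ,
    finrank_euclideanSpace_fin, measureReal_def, volume_real_ball_zero_one_fin_three]
  push_cast
  ring

/-! ## Polar coordinates on a shell about `x₀` -/

/-- **Polar coordinates on a shell about `x₀`**: for `g` integrable on `B_b(x₀) ∖ B_a(x₀)` with `0 < a ≤ b`,
`∫_{B_b(x₀)∖B_a(x₀)} g = ∫ₐᵇ r²·sphereIntegral volume (g(· + x₀)) r dr` (the inner sphere `‖y − x₀‖ = a` is a null set). [folklore] -/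
theorem setIntegral_shell_eq_intervalIntegral_sphereIntegral {g : EuclideanSpace ℝ (Fin 3) → ℝ}
    {x₀ : EuclideanSpace ℝ (Fin 3)} {a b : ℝ} (hg : IntegrableOn g (ball x₀ b \ ball x₀ a)) (ha : 0 < a) (hab : a ≤ b) :
    ∫ y in ball x₀ b \ ball x₀ a, g y = ∫ r in a..b, r ^ 2 * sphereIntegral volume (fun z => g (z + x₀)) r := by
  haveI : Nontrivial (EuclideanSpace ℝ (Fin 3)) :=
    Module.nontrivial_of_finrank_pos (R := ℝ) (by rw [finrank_euclideanSpace_fin]; norm_num)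
  -- translate to the origin
  have hmem : ∀ z : EuclideanSpace ℝ (Fin 3), z + x₀ ∈ ball x₀ b \ ball x₀ a ↔
      z ∈ ball (0 : EuclideanSpace ℝ (Fin 3)) b \ ball (0 : EuclideanSpace ℝ (Fin 3)) a := by
    intro z
    simp only [Set.mem_sdiff, mem_ball, dist_eq_norm, add_sub_cancel_right, sub_zero]
  have hind : (fun z => (ball x₀ b \ ball x₀ a).indicator g (z + x₀)) =
      (ball (0 : EuclideanSpace ℝ (Fin 3)) b \ ball 0 a).indicator fun z => g (z + x₀) := by
    funext z
    by_cases hz : z ∈ ball (0 : EuclideanSpace ℝ (Fin 3)) b \ ball 0 a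
    · simp only [indicator_of_mem hz, indicator_of_mem ((hmem z).2 hz)]
    · simp only [indicator_of_notMem hz, indicator_of_notMem (fun h => hz ((hmem z).1 h))]
  have hS : MeasurableSet (ball x₀ b \ ball x₀ a) := measurableSet_ball.diff measurableSet_ball
  have hS0 : MeasurableSet (ball (0 : EuclideanSpace ℝ (Fin 3)) b \ ball 0 a) := measurableSet_ball.diff measurableSet_ball
  have htrans : ∫ y in ball x₀ b \ ball x₀ a, g y =
      ∫ z in ball (0 : EuclideanSpace ℝ (Fin 3)) b \ ball 0 a, g (z + x₀) := by
    rw [← integral_indicator hS, ← integral_indicator hS0,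
      ← integral_add_right_eq_self (fun y => (ball x₀ b \ ball x₀ a).indicator g y) x₀, hind]
  have hg' : IntegrableOn (fun z => g (z + x₀)) (ball (0 : EuclideanSpace ℝ (Fin 3)) b \ ball 0 a) := by
    have h := (integrable_indicator_iff hS).2 hg
    have h2 : Integrable (fun z => (ball x₀ b \ ball x₀ a).indicator g (z + x₀)) := h.comp_add_right x₀
    rw [hind] at h2
    exact (integrable_indicator_iff hS0).1 h2
  -- the shell and the open shell agree a.e.
  have hae : (ball (0 : EuclideanSpace ℝ (Fin 3)) b \ ball 0 a : Set (EuclideanSpace ℝ (Fin 3))) =ᵐ[volume]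
      {x : EuclideanSpace ℝ (Fin 3) | a < ‖x‖ ∧ ‖x‖ < b} := by
    refine ae_eq_set.2 ⟨?_, ?_⟩
    · refine measure_mono_null (fun x hx => ?_) (Measure.addHaar_sphere volume (0 : EuclideanSpace ℝ (Fin 3)) a)
      obtain ⟨⟨h1, h2⟩, h3⟩ := hx
      rw [mem_ball_zero_iff] at h1
      rw [mem_ball_zero_iff, not_lt] at h2
      have h4 : ¬ a < ‖x‖ := fun h => h3 ⟨h, h1⟩
      rw [mem_sphere_zero_iff_norm]
      exact le_antisymm (not_lt.1 h4) h2
    · have : {x : EuclideanSpace ℝ (Fin 3) | a < ‖x‖ ∧ ‖x‖ < b} \ (ball 0 b \ ball 0 a) = ∅ := by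
        ext x
        constructor
        · rintro ⟨⟨h1, h2⟩, h3⟩
          exact (h3 ⟨mem_ball_zero_iff.2 h2, fun h => by rw [mem_ball_zero_iff] at h; linarith⟩).elim
        · intro h
          exact (Set.notMem_empty x h).elim
      rw [this]; exact measure_empty
  have hsub : {x : EuclideanSpace ℝ (Fin 3) | a < ‖x‖ ∧ ‖x‖ < b} ⊆ ball 0 b \ ball 0 a := by
    intro x hx
    exact ⟨mem_ball_zero_iff.2 hx.2, fun h => by rw [mem_ball_zero_iff] at h; linarith [hx.1]⟩
  rw [htrans, setIntegral_congr_set hae, setIntegral_shell_eq_integral_sphereIntegral volume (hg'.mono_set hsub) ha.le,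
    finrank_euclideanSpace_fin, intervalIntegral.integral_of_le hab,
    setIntegral_congr_set (Ioo_ae_eq_Ioc (μ := volume) (a := a) (b := b))]
  simp [smul_eq_mul]

/-- The shell integrand `‖z‖^{−α}(‖U‖² − αU_n² + (3−α)Q)` is integrable on every shell `B_{r₂}(x₀) ∖ B_{r₁}(x₀)`, `0 < r₁`
(continuous on the compact closed shell, which avoids `x₀`). [folklore] -/
theorem integrableOn_shell_rpow_integrand {U : EuclideanSpace ℝ (Fin 3) → EuclideanSpace ℝ (Fin 3)}
    {Q : EuclideanSpace ℝ (Fin 3) → ℝ} (hU : Continuous U) (hQ : Continuous Q) (x₀ : EuclideanSpace ℝ (Fin 3)) (α : ℝ)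
    {r₁ : ℝ} (hr₁ : 0 < r₁) (r₂ : ℝ) :
    IntegrableOn (fun y => ‖y - x₀‖ ^ (-α) *
        (‖U y‖ ^ 2 - α * (⟪U y, y - x₀⟫ ^ 2 / ‖y - x₀‖ ^ 2) + (3 - α) * Q y)) (ball x₀ r₂ \ ball x₀ r₁) := by
  have hK : IsCompact (closedBall x₀ r₂ \ ball x₀ r₁) := (isCompact_closedBall x₀ r₂).diff isOpen_ball
  refine (ContinuousOn.integrableOn_compact hK ?_).mono_set fun y hy => ⟨ball_subset_closedBall hy.1, hy.2⟩
  intro y hy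
  have hy0 : y - x₀ ≠ 0 := by
    intro h
    have : y ∈ ball x₀ r₁ := by rw [mem_ball, dist_eq_norm, h, norm_zero]; exact hr₁
    exact hy.2 this
  have hn : ‖y - x₀‖ ≠ 0 := norm_ne_zero_iff.2 hy0
  refine ContinuousAt.continuousWithinAt ?_
  have h1 : ContinuousAt (fun y : EuclideanSpace ℝ (Fin 3) => ‖y - x₀‖ ^ (-α)) y :=
    ((continuous_id.sub continuous_const).norm.continuousAt).rpow_const (Or.inl hn)
  have h2 : ContinuousAt (fun y : EuclideanSpace ℝ (Fin 3) => ⟪U y, y - x₀⟫ ^ 2 / ‖y - x₀‖ ^ 2) y :=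
    (((hU.inner (continuous_id.sub continuous_const)).pow 2).continuousAt).div
      (((continuous_id.sub continuous_const).norm.pow 2).continuousAt) (pow_ne_zero 2 hn)
  exact h1.mul ((((hU.norm.pow 2).continuousAt).sub (continuousAt_const.mul h2)).add
    (continuousAt_const.mul hQ.continuousAt))

/-! ## The differential and integrated shell laws for a pair satisfying the tent mean-value formula -/

section ShellLaw

variable {U : EuclideanSpace ℝ (Fin 3) → EuclideanSpace ℝ (Fin 3)} {Q : EuclideanSpace ℝ (Fin 3) → ℝ}
  {x₀ : EuclideanSpace ℝ (Fin 3)}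

/-- The sphere integral of `‖U‖² − αU_n² + (3−α)Q` at radius `r > 0`, as `S_f(r) − α·S(r)` with the two continuous radial densities
`S_f = sphereIntegral(‖U‖² + 3Q)`, `S(r) = ∫_σ(⟪U(rα+x₀),α⟫² + Q(rα+x₀))dσ`. [folklore] -/
theorem sphereIntegral_shellIntegrand_eq (hU : Continuous U) (hQ : Continuous Q) (x₀ : EuclideanSpace ℝ (Fin 3)) (α : ℝ)
    {r : ℝ} (hr : 0 < r) :
    sphereIntegral volume (fun z : EuclideanSpace ℝ (Fin 3) =>
        ‖U (z + x₀)‖ ^ 2 - α * (⟪U (z + x₀), z⟫ ^ 2 / ‖z‖ ^ 2) + (3 - α) * Q (z + x₀)) r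
      = sphereIntegral volume (fun z : EuclideanSpace ℝ (Fin 3) => ‖U (z + x₀)‖ ^ 2 + 3 * Q (z + x₀)) r
        - α * ∫ θ : sphere (0 : EuclideanSpace ℝ (Fin 3)) 1,
          (⟪U (r • (θ : EuclideanSpace ℝ (Fin 3)) + x₀), (θ : EuclideanSpace ℝ (Fin 3))⟫ ^ 2 +
            Q (r • (θ : EuclideanSpace ℝ (Fin 3)) + x₀)) ∂(volume : Measure (EuclideanSpace ℝ (Fin 3))).toSphere := by
  rw [sphereIntegral_def, sphereIntegral_def]
  have hc0 : Continuous fun θ : sphere (0 : EuclideanSpace ℝ (Fin 3)) 1 => r • (θ : EuclideanSpace ℝ (Fin 3)) + x₀ := by fun_prop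
  have hcF : Continuous fun θ : sphere (0 : EuclideanSpace ℝ (Fin 3)) 1 =>
      ‖U (r • (θ : EuclideanSpace ℝ (Fin 3)) + x₀)‖ ^ 2 + 3 * Q (r • (θ : EuclideanSpace ℝ (Fin 3)) + x₀) :=
    ((hU.comp hc0).norm.pow 2).add (continuous_const.mul (hQ.comp hc0))
  have hcS : Continuous fun θ : sphere (0 : EuclideanSpace ℝ (Fin 3)) 1 =>
      ⟪U (r • (θ : EuclideanSpace ℝ (Fin 3)) + x₀), (θ : EuclideanSpace ℝ (Fin 3))⟫ ^ 2 +
        Q (r • (θ : EuclideanSpace ℝ (Fin 3)) + x₀) :=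
    (((hU.comp hc0).inner continuous_subtype_val).pow 2).add (hQ.comp hc0)
  rw [← integral_const_mul, ← integral_sub (integrable_sphere_of_continuous hcF)
    ((integrable_sphere_of_continuous hcS).const_mul α)]
  refine integral_congr_ae (Eventually.of_forall fun θ => ?_)
  dsimp only
  rw [norm_smul_sphere hr.le θ, inner_smul_right]
  field_simp
  ring

/-- **THE DIFFERENTIAL SHELL LAW (core form).**  For continuous `U`, `Q` satisfying the tent mean-value formula about `x₀` at every
radius, every real `α` and `r > 0`: `t ↦ t^{3−α}·S(t)` has derivative `r^{2−α}(S_f(r) − αS(r))` at `r`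
(`S`, `S_f` the two continuous radial densities). [cite: ChaeWolf2016, Remark 2.3 (2.8)] [folklore] -/
theorem hasDerivAt_rpow_mul_radialDensity_of_meanValue (hU : Continuous U) (hQ : Continuous Q) (x₀ : EuclideanSpace ℝ (Fin 3))
    (hMV : ∀ ρ : ℝ, 0 < ρ →
      ∫ y in ball x₀ ρ, (⟪U y, y - x₀⟫ ^ 2 / ‖y - x₀‖ + ‖y - x₀‖ * Q y)
        = ∫ y in ball x₀ ρ, (ρ - ‖y - x₀‖) * (‖U y‖ ^ 2 + 3 * Q y))
    (α : ℝ) {r : ℝ} (hr : 0 < r) :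
    HasDerivAt (fun t : ℝ => t ^ (3 - α) * ∫ θ : sphere (0 : EuclideanSpace ℝ (Fin 3)) 1,
          (⟪U (t • (θ : EuclideanSpace ℝ (Fin 3)) + x₀), (θ : EuclideanSpace ℝ (Fin 3))⟫ ^ 2 +
            Q (t • (θ : EuclideanSpace ℝ (Fin 3)) + x₀)) ∂(volume : Measure (EuclideanSpace ℝ (Fin 3))).toSphere)
      (r ^ (2 - α) * (sphereIntegral volume (fun z : EuclideanSpace ℝ (Fin 3) => ‖U (z + x₀)‖ ^ 2 + 3 * Q (z + x₀)) r
        - α * ∫ θ : sphere (0 : EuclideanSpace ℝ (Fin 3)) 1,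
          (⟪U (r • (θ : EuclideanSpace ℝ (Fin 3)) + x₀), (θ : EuclideanSpace ℝ (Fin 3))⟫ ^ 2 +
            Q (r • (θ : EuclideanSpace ℝ (Fin 3)) + x₀)) ∂(volume : Measure (EuclideanSpace ℝ (Fin 3))).toSphere)) r := by
  set S : ℝ → ℝ := fun t => ∫ θ : sphere (0 : EuclideanSpace ℝ (Fin 3)) 1,
      (⟪U (t • (θ : EuclideanSpace ℝ (Fin 3)) + x₀), (θ : EuclideanSpace ℝ (Fin 3))⟫ ^ 2 +
        Q (t • (θ : EuclideanSpace ℝ (Fin 3)) + x₀)) ∂(volume : Measure (EuclideanSpace ℝ (Fin 3))).toSphere with hS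
  set Sf : ℝ → ℝ := fun t => sphereIntegral volume
      (fun z : EuclideanSpace ℝ (Fin 3) => ‖U (z + x₀)‖ ^ 2 + 3 * Q (z + x₀)) t with hSf
  have hfc : Continuous fun z : EuclideanSpace ℝ (Fin 3) => ‖U (z + x₀)‖ ^ 2 + 3 * Q (z + x₀) := by fun_prop
  have hSfc : Continuous Sf := continuous_sphereIntegral volume hfc
  -- `t³ S(t) = ∫₀ᵗ τ² S_f(τ) dτ` for `t > 0` (sphere mean-value formula + polar coordinates)
  have hIf : ∀ ρ : ℝ, IntegrableOn (fun y => ‖U y‖ ^ 2 + 3 * Q y) (ball x₀ ρ) := fun ρ =>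
    ((by fun_prop : Continuous fun y => ‖U y‖ ^ 2 + 3 * Q y).continuousOn.integrableOn_compact
      (isCompact_closedBall x₀ ρ)).mono_set ball_subset_closedBall
  have hG : ∀ t : ℝ, 0 < t → t ^ 3 * S t = ∫ τ in (0 : ℝ)..t, τ ^ 2 * Sf τ := by
    intro t ht
    have h := sphereMeanValueFormula_of_meanValue hU hQ x₀ hMV ht
    rw [sphereIntegral_normalSq_eq x₀ ht, setIntegral_ball_eq_intervalIntegral_sphereIntegral (hIf t) ht.le] at h
    exact h
  -- differentiate `t^{−α} · (t³ S(t))`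
  have hΦ : HasDerivAt (fun t : ℝ => ∫ τ in (0 : ℝ)..t, τ ^ 2 * Sf τ) (r ^ 2 * Sf r) r :=
    (((continuous_pow 2).mul hSfc).integral_hasStrictDerivAt 0 r).hasDerivAt
  have hG' : HasDerivAt (fun t : ℝ => t ^ 3 * S t) (r ^ 2 * Sf r) r := by
    refine hΦ.congr_of_eventuallyEq ?_
    filter_upwards [Ioi_mem_nhds hr] with t ht
    exact hG t ht
  have hpow : HasDerivAt (fun t : ℝ => t ^ (-α)) (-α * r ^ (-α - 1)) r := Real.hasDerivAt_rpow_const (Or.inl hr.ne')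
  have hH := hpow.mul hG'
  have heq : (fun t : ℝ => t ^ (-α) * (t ^ 3 * S t)) =ᶠ[𝓝 r] fun t : ℝ => t ^ (3 - α) * S t := by
    filter_upwards [Ioi_mem_nhds hr] with t ht
    have e : t ^ (3 - α) = t ^ (-α) * t ^ 3 := by
      rw [← Real.rpow_natCast t 3, ← Real.rpow_add ht]
      norm_num
      ring_nf
    rw [e, mul_assoc]
  refine (hH.congr_of_eventuallyEq heq.symm).congr_deriv ?_
  have e1 : r ^ (-α - 1) * r ^ 3 = r ^ (2 - α) := by
    rw [← Real.rpow_natCast r 3, ← Real.rpow_add hr]; norm_num; ring_nf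
  have e2 : r ^ (-α) * r ^ 2 = r ^ (2 - α) := by
    rw [← Real.rpow_natCast r 2, ← Real.rpow_add hr]; norm_num; ring_nf
  linear_combination (-α * S r) * e1 + Sf r * e2

/-- **THE DIFFERENTIAL SHELL LAW** (Chae–Wolf (2.8) differentiated, for a pair).  For continuous `U`, `Q` satisfying the tent
mean-value formula about `x₀` at every radius, every real `α` and `r > 0`:
`d/dt|_{t=r} [t^{3−α}·sphereIntegral volume (z ↦ ⟪U(z+x₀),z⟫²/‖z‖² + Q(z+x₀)) t]
   = r^{2−α}·sphereIntegral volume (z ↦ ‖U(z+x₀)‖² − α⟪U(z+x₀),z⟫²/‖z‖² + (3−α)Q(z+x₀)) r`.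
[cite: ChaeWolf2016, Remark 2.3 (2.8)] [folklore] -/
theorem hasDerivAt_rpow_mul_sphereIntegral_of_meanValue (hU : Continuous U) (hQ : Continuous Q)
    (x₀ : EuclideanSpace ℝ (Fin 3))
    (hMV : ∀ ρ : ℝ, 0 < ρ →
      ∫ y in ball x₀ ρ, (⟪U y, y - x₀⟫ ^ 2 / ‖y - x₀‖ + ‖y - x₀‖ * Q y)
        = ∫ y in ball x₀ ρ, (ρ - ‖y - x₀‖) * (‖U y‖ ^ 2 + 3 * Q y))
    (α : ℝ) {r : ℝ} (hr : 0 < r) :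
    HasDerivAt (fun t : ℝ => t ^ (3 - α) * sphereIntegral volume
        (fun z : EuclideanSpace ℝ (Fin 3) => ⟪U (z + x₀), z⟫ ^ 2 / ‖z‖ ^ 2 + Q (z + x₀)) t)
      (r ^ (2 - α) * sphereIntegral volume (fun z : EuclideanSpace ℝ (Fin 3) =>
        ‖U (z + x₀)‖ ^ 2 - α * (⟪U (z + x₀), z⟫ ^ 2 / ‖z‖ ^ 2) + (3 - α) * Q (z + x₀)) r) r := by
  have h := hasDerivAt_rpow_mul_radialDensity_of_meanValue hU hQ x₀ hMV α hr
  rw [← sphereIntegral_shellIntegrand_eq hU hQ x₀ α hr] at h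
  refine h.congr_of_eventuallyEq ?_
  filter_upwards [Ioi_mem_nhds hr] with t ht
  rw [sphereIntegral_normalSq_eq x₀ ht]

/-- **THE INTEGRATED SHELL LAW** (Chae–Wolf Remark 2.3 (2.8), for a pair, every real `α`).  For continuous `U`, `Q` satisfying the
tent mean-value formula about `x₀` at every radius and `0 < r₁ < r₂`:
`r₂^{3−α}·sphereIntegral(U_n² + Q)(r₂) − r₁^{3−α}·sphereIntegral(U_n² + Q)(r₁)
   = ∫_{B_{r₂}(x₀)∖B_{r₁}(x₀)} ‖y−x₀‖^{−α}(‖U‖² − α⟪U,y−x₀⟫²/‖y−x₀‖² + (3−α)Q) dy`.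
[cite: ChaeWolf2016, Remark 2.3 (2.8)] [folklore] -/
theorem shellLaw_of_meanValue (hU : Continuous U) (hQ : Continuous Q) (x₀ : EuclideanSpace ℝ (Fin 3))
    (hMV : ∀ ρ : ℝ, 0 < ρ →
      ∫ y in ball x₀ ρ, (⟪U y, y - x₀⟫ ^ 2 / ‖y - x₀‖ + ‖y - x₀‖ * Q y)
        = ∫ y in ball x₀ ρ, (ρ - ‖y - x₀‖) * (‖U y‖ ^ 2 + 3 * Q y))
    (α : ℝ) {r₁ r₂ : ℝ} (hr₁ : 0 < r₁) (h12 : r₁ < r₂) :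
    r₂ ^ (3 - α) * sphereIntegral volume
          (fun z : EuclideanSpace ℝ (Fin 3) => ⟪U (z + x₀), z⟫ ^ 2 / ‖z‖ ^ 2 + Q (z + x₀)) r₂
      - r₁ ^ (3 - α) * sphereIntegral volume
          (fun z : EuclideanSpace ℝ (Fin 3) => ⟪U (z + x₀), z⟫ ^ 2 / ‖z‖ ^ 2 + Q (z + x₀)) r₁
      = ∫ y in ball x₀ r₂ \ ball x₀ r₁, ‖y - x₀‖ ^ (-α) *
          (‖U y‖ ^ 2 - α * (⟪U y, y - x₀⟫ ^ 2 / ‖y - x₀‖ ^ 2) + (3 - α) * Q y) := by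
  have hr₂ : 0 < r₂ := hr₁.trans h12
  set S : ℝ → ℝ := fun t => ∫ θ : sphere (0 : EuclideanSpace ℝ (Fin 3)) 1,
      (⟪U (t • (θ : EuclideanSpace ℝ (Fin 3)) + x₀), (θ : EuclideanSpace ℝ (Fin 3))⟫ ^ 2 +
        Q (t • (θ : EuclideanSpace ℝ (Fin 3)) + x₀)) ∂(volume : Measure (EuclideanSpace ℝ (Fin 3))).toSphere with hS
  set Sf : ℝ → ℝ := fun t => sphereIntegral volume
      (fun z : EuclideanSpace ℝ (Fin 3) => ‖U (z + x₀)‖ ^ 2 + 3 * Q (z + x₀)) t with hSf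
  have hSc : Continuous S := continuous_radialNormalDensity hU hQ x₀
  have hfc : Continuous fun z : EuclideanSpace ℝ (Fin 3) => ‖U (z + x₀)‖ ^ 2 + 3 * Q (z + x₀) := by fun_prop
  have hSfc : Continuous Sf := continuous_sphereIntegral volume hfc
  -- the derivative `g(t) = t^{2−α}(S_f(t) − αS(t))` is continuous on `[r₁, r₂]`
  have hpos : ∀ t ∈ uIcc r₁ r₂, 0 < t := by
    intro t ht
    rw [uIcc_of_le h12.le] at ht
    exact hr₁.trans_le ht.1
  have hgc : ContinuousOn (fun t : ℝ => t ^ (2 - α) * (Sf t - α * S t)) (uIcc r₁ r₂) :=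
    (continuousOn_id.rpow_const fun t ht => Or.inl (hpos t ht).ne').mul
      (hSfc.continuousOn.sub (continuousOn_const.mul hSc.continuousOn))
  -- FTC on `[r₁, r₂]`
  have hderiv : ∀ t ∈ uIcc r₁ r₂, HasDerivAt (fun t : ℝ => t ^ (3 - α) * S t) (t ^ (2 - α) * (Sf t - α * S t)) t :=
    fun t ht => hasDerivAt_rpow_mul_radialDensity_of_meanValue hU hQ x₀ hMV α (hpos t ht)
  have hFTC := intervalIntegral.integral_eq_sub_of_hasDerivAt hderiv (hgc.intervalIntegrable)
  -- polar coordinates on the shell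
  have hshell := setIntegral_shell_eq_intervalIntegral_sphereIntegral
    (integrableOn_shell_rpow_integrand hU hQ x₀ α hr₁ r₂) hr₁ h12.le
  have hrad : ∀ t ∈ uIcc r₁ r₂, t ^ 2 * sphereIntegral volume (fun z : EuclideanSpace ℝ (Fin 3) =>
      ‖z + x₀ - x₀‖ ^ (-α) * (‖U (z + x₀)‖ ^ 2 - α * (⟪U (z + x₀), z + x₀ - x₀⟫ ^ 2 / ‖z + x₀ - x₀‖ ^ 2)
        + (3 - α) * Q (z + x₀))) t = t ^ (2 - α) * (Sf t - α * S t) := by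
    intro t ht
    have ht0 := hpos t ht
    have key := sphereIntegral_radial_mul (fun s : ℝ => s ^ (-α))
      (fun w => ‖U w‖ ^ 2 - α * (⟪U w, w - x₀⟫ ^ 2 / ‖w - x₀‖ ^ 2) + (3 - α) * Q w) x₀ ht0.le
    simp only [add_sub_cancel_right] at key ⊢
    rw [key, sphereIntegral_shellIntegrand_eq hU hQ x₀ α ht0]
    have e3 : t ^ 2 * t ^ (-α) = t ^ (2 - α) := by
      rw [← Real.rpow_natCast t 2, ← Real.rpow_add ht0]; norm_num; ring_nf
    rw [← mul_assoc, e3]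
  rw [hshell, intervalIntegral.integral_congr hrad, hFTC]
  simp only [hS]
  rw [← sphereIntegral_normalSq_eq x₀ hr₂, ← sphereIntegral_normalSq_eq x₀ hr₁]

end ShellLaw

end ClassicalProfile

end Summit.NavierStokesRegularity.NavierStokesRegularity.Theorems.PowerGaugeEulerLiouville

end
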